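import Summits.ResolutionOfSingularities.ResolutionOfSingularities.Theorems.FrobeniusLadderFInjectiveMacaulayficationX2Cubic4FloorFullCert
import Summits.ResolutionOfSingularities.ResolutionOfSingularities.Theorems.FrobeniusLadderFInjectiveMacaulayficationX2Cubic4Specimen
import Summits.ResolutionOfSingularities.ResolutionOfSingularities.Theorems.FrobeniusLadderFInjectiveMacaulayficationE4GermSpecimen
import Mathlib.Data.Nat.Factorial.BigOperators
import HarnessLib

/-!
# (RR-I2) THE VERTEX OF `Y = {x² + y³ + u³ + t³ + s³}` IS FULL FOR **EVERY** PRIME `p ∉ {2, 3}`: a two-stage `p`-uniform derivative certificate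
# (crux `FInjectiveMacaulayfication` stmt-ResolutionOfSingularities-15315, chain w45a; closes the last caveat of the second T″ kernel instance ✓ `X2Cubic4FloorTwoGlue.
# tStepInstanceAt_x2cubic4_origin`: the base point `v` is a CLOSED, SINGULAR, **FULL** point of local dimension 4 — i.e. `(Y, v)` is in the scope of the T″ stub for all `p ≥ 5`;
# engine = ✓ `TCaFloorOneFull.clause_at_maximal_of_derivative_certificate` (generic `p`); seat res-L1-w45a-lead-1 g11)

[OURS · L1 W4.5a] Support file (`--supports stmt-ResolutionOfSingularities-15315 --as helper`); def-free; UNCONDITIONAL; no named fact; NOT a statement of any manuscript.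
AI-written (AI review is weaker than expert review).

THE CERTIFICATE (uniform in the odd prime `p ≠ 3`; `h = (p−1)/2`, `b = ⌊(p−1)/3⌋`, `a = h − b`, so `3a, 3b ≤ p − 1`). `f = X₄² + c`, `c = X₀³ + X₁³ + X₂³ + X₃³`. For a `∂`-stable
`T ∋ f^{p−1}`, `I = (T)`:
* STAGE 1 (`∂₄`): `f^{p−1} = Σᵢ C(p−1,i)·X₄^{2i}·c^{p−1−i}` and `∂₄^{p−1}(X₄^{2i}·c^{p−1−i}) = (2i)^{(p−1)}·X₄^{2i−p+1}·c^{p−1−i}`; the falling factorial `(2i)^{(p−1)}` vanishes for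
  `2i < p−1`, is `(p−1)!` at `i = h`, and is DIVISIBLE BY `p` for `i > h` (the `p−1` consecutive integers `2i−p+2, …, 2i` contain `p`); so
  `∂₄^{p−1}(f^{p−1}) = (p−1)!·C(p−1,h)·c^h` and `c^h ∈ I`.
* STAGE 2 (`∂₀^{3a}` then `∂₁^{3b}`, `a + b = h`): `c^h = Σⱼ C(h,j)·X₀^{3j}·r^{h−j}` (`r = X₁³ + X₂³ + X₃³`), `∂₀^{3a}` kills `j < a`; then `r^{m} = Σₗ C(m,l)·X₁^{3l}·r′^{m−l}`
  (`r′ = X₂³ + X₃³`) and `∂₁^{3b}` kills every term with `l < b`, in particular ALL of `r^{h−j}` for `j > a` (`l ≤ h−j < b`); the single survivor `j = a`, `l = b` gives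
  `∂₁^{3b}∂₀^{3a}(c^h) = C(h,a)·(3a)!·(3b)!`, a UNIT (all of `h, 3a, 3b < p`). Hence `1 ∈ I`.
So (`clause_at_maximal_of_derivative_certificate`) the FULL clause holds at EVERY closed point of `Y`, and ★★★ `fullCl_Spec_stalk_vertex`: `FullCl p (𝒪_{Y,v})`.
* §1 `iterate_span_pderiv_mem`; `dvd_descFactorial_two_mul` (the divisibility); `choose_ne_zero_of_lt` / `factorial_ne_zero_of_lt` (units mod `p`).
* §2 ★ `iterate_pderiv_f_pow` (stage 1), `c_pow_mem`.  §3 `iterate_pderiv_r_pow_eq_zero`, `iterate_pderiv_r_pow_self`, ★ `iterate_iterate_c_pow` (stage 2).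
* §4 ★★ `hcert_f`, ★★ `clause_f` (every maximal ideal of `k[X]/(f)`), ★★★ `fullCl_Spec_stalk_vertex`, `fullCl_Spec_stalk_vertex_charP`.
[cite: Fedder1983, Prop. 1.7, Thm. 1.12] [folklore]
-/

-- single-problem summit: the doubled namespace component is forced
set_option linter.dupNamespace false

noncomputable section

open MvPolynomial

namespace Summit.ResolutionOfSingularities.ResolutionOfSingularities.Theorems.FInjectiveMacaulayfication.X2Cubic4VertexFull

open Summit.ResolutionOfSingularities.ResolutionOfSingularities.Theorems.FInjectiveMacaulayfication
open AlgebraicGeometry SliceableCentre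

variable (k : Type) [Field k]

/-! ## §1 Plumbing: iterates in a `∂`-stable ideal; arithmetic of the falling factorials -/

/-- Iterated partials of an element of the ideal spanned by a `∂`-stable set stay in that ideal. [plumbing] -/
theorem iterate_span_pderiv_mem (T : Set (MvPolynomial (Fin 5) k)) (hT : ∀ s ∈ T, ∀ i : Fin 5, pderiv i s ∈ T) (i : Fin 5) :
    ∀ (j : ℕ) {h : MvPolynomial (Fin 5) k}, h ∈ Ideal.span T → (fun q => pderiv i q)^[j] h ∈ Ideal.span T := by
  intro j
  induction j with
  | zero => intro h hh; exact hh
  | succ j ih => intro h hh; rw [Function.iterate_succ_apply']; exact X2Cubic4FloorFullCert.span_pderiv_mem T hT i (ih hh)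

/-- The iterate of `∂_i` as a power of the linear map `∂_i`. [plumbing] -/
theorem iterate_eq_pow_apply (i : Fin 5) (j : ℕ) (q : MvPolynomial (Fin 5) k) :
    (fun q => pderiv i q)^[j] q = ((pderiv i : Derivation k (MvPolynomial (Fin 5) k) (MvPolynomial (Fin 5) k)).toLinearMap ^ j) q := by
  rw [Module.End.pow_apply]
  rfl

/-- Iterated partials commute with natural-number scalars. [plumbing] -/
theorem iterate_pderiv_natCast_mul (i : Fin 5) (j N : ℕ) (q : MvPolynomial (Fin 5) k) :
    (fun q => pderiv i q)^[j] ((N : MvPolynomial (Fin 5) k) * q) = (N : MvPolynomial (Fin 5) k) * (fun q => pderiv i q)^[j] q := by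
  rw [iterate_eq_pow_apply, iterate_eq_pow_apply, ← nsmul_eq_mul, ← nsmul_eq_mul, map_nsmul]

/-- Iterated partials are additive over finite sums. [plumbing] -/
theorem iterate_pderiv_finset_sum (i : Fin 5) (j : ℕ) (s : Finset ℕ) (F : ℕ → MvPolynomial (Fin 5) k) :
    (fun q => pderiv i q)^[j] (s.sum F) = s.sum fun x => (fun q => pderiv i q)^[j] (F x) := by
  simp only [iterate_eq_pow_apply, map_sum]

/-- **The falling factorial `(2i)(2i−1)⋯(2i−p+2)` is divisible by `p` when `p ≤ 2i ≤ 2p − 2`** (its `p − 1` consecutive factors contain `p`). [elementary] -/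
theorem dvd_descFactorial_two_mul (p i : ℕ) (hp : 1 < p) (hlo : p ≤ 2 * i) (hhi : 2 * i ≤ 2 * p - 2) : p ∣ (2 * i).descFactorial (p - 1) := by
  rw [Nat.descFactorial_eq_prod_range]
  have hmem : 2 * i - p ∈ Finset.range (p - 1) := Finset.mem_range.mpr (by omega)
  have := Finset.dvd_prod_of_mem (fun j => 2 * i - j) hmem
  rwa [show 2 * i - (2 * i - p) = p by omega] at this

/-- `n! ≠ 0` in `k` for `n < p = char k`. [elementary] -/
theorem factorial_cast_ne_zero (p : ℕ) [Fact p.Prime] [CharP k p] (n : ℕ) (hn : n < p) : ((n.factorial : ℕ) : k) ≠ 0 := by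
  rw [Ne, CharP.cast_eq_zero_iff k p, (Fact.out : p.Prime).dvd_factorial]
  omega

/-- `C(n, m) ≠ 0` in `k` for `m ≤ n < p = char k` (`C(n,m)·m!·(n−m)! = n!`). [elementary] -/
theorem choose_cast_ne_zero (p : ℕ) [Fact p.Prime] [CharP k p] (n m : ℕ) (hm : m ≤ n) (hn : n < p) : ((n.choose m : ℕ) : k) ≠ 0 := by
  rw [Ne, CharP.cast_eq_zero_iff k p]
  intro hdvd
  have h2 : p ∣ n.factorial := by
    rw [← Nat.choose_mul_factorial_mul_factorial hm]
    exact (hdvd.mul_right _).mul_right _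
  rw [(Fact.out : p.Prime).dvd_factorial] at h2
  omega

/-- A natural-number multiple `N·q ∈ I` with `N ≠ 0` in `k` gives `q ∈ I`. [plumbing] -/
theorem mem_of_natCast_mul_mem {N : ℕ} (hN : ((N : ℕ) : k) ≠ 0) (I : Ideal (MvPolynomial (Fin 5) k)) (q : MvPolynomial (Fin 5) k)
    (h : (N : MvPolynomial (Fin 5) k) * q ∈ I) : q ∈ I := by
  have := Ideal.mul_mem_left _ (C (((N : ℕ) : k)⁻¹)) h
  rwa [← mul_assoc, ← map_natCast (C : k →+* MvPolynomial (Fin 5) k), ← map_mul, inv_mul_cancel₀ hN, map_one, one_mul] at this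

/-! ## §2 Stage 1: `∂₄^{p−1}(f^{p−1}) = (p−1)!·C(p−1,h)·c^h`, so `c^h ∈ I` -/

/-- `f^{p−1}` by the binomial theorem in `X₄²` and `c`. [plumbing] -/
theorem f_pow_eq_sum (p : ℕ) (hp : 0 < p) (f c : MvPolynomial (Fin 5) k) (hf : f = X 4 ^ 2 + c) :
    f ^ (p - 1) = (Finset.range p).sum fun i => ((p - 1).choose i : MvPolynomial (Fin 5) k) * (X 4 ^ (2 * i) * c ^ (p - 1 - i)) := by
  have hp1 : p - 1 + 1 = p := Nat.sub_add_cancel hp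
  rw [hf, add_pow, hp1]
  refine Finset.sum_congr rfl fun i _ => ?_
  rw [← pow_mul]
  ring

/-- ★ **Stage 1: `∂₄^{p−1}(f^{p−1}) = (p−1)!·C(p−1,(p−1)/2)·c^{(p−1)/2}`** for `f = X₄² + c`, `∂₄ c = 0`, `p` an odd prime. [folklore computation] -/
theorem iterate_pderiv_f_pow (p : ℕ) [Fact p.Prime] [CharP k p] (hp2 : p ≠ 2) (f c : MvPolynomial (Fin 5) k) (hf : f = X 4 ^ 2 + c)
    (hc4 : pderiv 4 c = 0) :
    (fun q => pderiv 4 q)^[p - 1] (f ^ (p - 1)) =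
      (((p - 1).factorial * (p - 1).choose ((p - 1) / 2) : ℕ) : MvPolynomial (Fin 5) k) * c ^ ((p - 1) / 2) := by
  have hp : p.Prime := Fact.out
  have hpos : 0 < p := hp.pos
  have hodd : p % 2 = 1 := hp.eq_two_or_odd.resolve_left hp2
  have hcpow : ∀ m : ℕ, pderiv 4 (c ^ m) = 0 := fun m => by rw [Derivation.leibniz_pow, hc4, smul_zero, smul_zero]
  rw [f_pow_eq_sum k p hpos f c hf, iterate_pderiv_finset_sum, Finset.sum_eq_single ((p - 1) / 2)]
  · rw [iterate_pderiv_natCast_mul, X2Cubic4FloorFullCert.iterate_pderiv_X_pow_mul (4 : Fin 5) _ (hcpow _) (p - 1) (2 * ((p - 1) / 2)),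
      show 2 * ((p - 1) / 2) = p - 1 by omega, Nat.descFactorial_self, Nat.sub_self, show p - 1 - (p - 1) / 2 = (p - 1) / 2 by omega, pow_zero, one_mul]
    push_cast
    ring
  · intro i hi hne
    rw [iterate_pderiv_natCast_mul, X2Cubic4FloorFullCert.iterate_pderiv_X_pow_mul (4 : Fin 5) _ (hcpow _) (p - 1) (2 * i)]
    by_cases hlt : 2 * i < p - 1
    · rw [(Nat.descFactorial_eq_zero_iff_lt).mpr hlt]
      simp
    · have hi' := Finset.mem_range.mp hi
      have hdvd : p ∣ (2 * i).descFactorial (p - 1) := dvd_descFactorial_two_mul p i hp.one_lt (by omega) (by omega)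
      rw [(CharP.cast_eq_zero_iff (MvPolynomial (Fin 5) k) p _).mpr hdvd]
      simp
  · intro hnot
    exact absurd (Finset.mem_range.mpr (by omega : (p - 1) / 2 < p)) hnot

/-- **`c^{(p−1)/2} ∈ (T)`** for every `∂`-stable `T ∋ f^{p−1}` (`p` an odd prime). [OURS · stage 1] -/
theorem c_pow_mem (p : ℕ) [Fact p.Prime] [CharP k p] (hp2 : p ≠ 2) (f c : MvPolynomial (Fin 5) k) (hf : f = X 4 ^ 2 + c) (hc4 : pderiv 4 c = 0)
    (T : Set (MvPolynomial (Fin 5) k)) (hfT : f ^ (p - 1) ∈ T) (hT : ∀ s ∈ T, ∀ i : Fin 5, pderiv i s ∈ T) :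
    c ^ ((p - 1) / 2) ∈ Ideal.span T := by
  have hp : p.Prime := Fact.out
  have hmem : (((p - 1).factorial * (p - 1).choose ((p - 1) / 2) : ℕ) : MvPolynomial (Fin 5) k) * c ^ ((p - 1) / 2) ∈ Ideal.span T := by
    rw [← iterate_pderiv_f_pow k p hp2 f c hf hc4]
    exact Ideal.subset_span (X2Cubic4FloorFullCert.iterate_pderiv_mem T hT 4 (p - 1) hfT)
  refine mem_of_natCast_mul_mem k ?_ _ _ hmem
  rw [Nat.cast_mul]
  exact mul_ne_zero (factorial_cast_ne_zero k p _ (Nat.sub_lt hp.pos Nat.one_pos))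
    (choose_cast_ne_zero k p _ _ (Nat.div_le_self _ _) (Nat.sub_lt hp.pos Nat.one_pos))

/-! ## §3 Stage 2: `∂₁^{3b} ∂₀^{3a} (c^h) = C(h,a)·(3a)!·(3b)!` -/

/-- `∂₁^{3b}` kills `X₀^e · r^m` for `m < b` (`r = X₁³ + r′`, `∂₁ r′ = 0`): every term of `r^m` has `X₁`-degree `3l ≤ 3m < 3b`. [OURS · vanishing] -/
theorem iterate_pderiv_one_r_pow_eq_zero (b m e : ℕ) (hm : m < b) (r r' : MvPolynomial (Fin 5) k) (hr : r = X 1 ^ 3 + r') (hr'1 : pderiv 1 r' = 0) :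
    (fun q => pderiv 1 q)^[3 * b] (X 0 ^ e * r ^ m) = 0 := by
  have hcof : ∀ n : ℕ, pderiv 1 (X 0 ^ e * r' ^ n : MvPolynomial (Fin 5) k) = 0 := fun n => by
    rw [Derivation.leibniz, Derivation.leibniz_pow, Derivation.leibniz_pow, hr'1, pderiv_X_of_ne (show (0 : Fin 5) ≠ 1 by decide)]
    simp
  have hexp : X 0 ^ e * r ^ m =
      (Finset.range (m + 1)).sum fun l => (m.choose l : MvPolynomial (Fin 5) k) * (X 1 ^ (3 * l) * (X 0 ^ e * r' ^ (m - l))) := by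
    rw [hr, add_pow, Finset.mul_sum]
    refine Finset.sum_congr rfl fun l _ => ?_
    rw [← pow_mul]
    ring
  rw [hexp, iterate_pderiv_finset_sum]
  refine Finset.sum_eq_zero fun l hl => ?_
  rw [iterate_pderiv_natCast_mul, X2Cubic4FloorFullCert.iterate_pderiv_X_pow_mul (1 : Fin 5) _ (hcof _) (3 * b) (3 * l),
    (Nat.descFactorial_eq_zero_iff_lt).mpr (by have := Finset.mem_range.mp hl; omega)]
  simp

/-- `∂₁^{3b}(X₀^e · r^b) = (3b)! · X₀^e` (`r = X₁³ + r′`, `∂₁ r′ = 0`): only the term `X₁^{3b}` of `r^b` survives. [OURS · the survivor] -/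
theorem iterate_pderiv_one_r_pow_self (b e : ℕ) (r r' : MvPolynomial (Fin 5) k) (hr : r = X 1 ^ 3 + r') (hr'1 : pderiv 1 r' = 0) :
    (fun q => pderiv 1 q)^[3 * b] (X 0 ^ e * r ^ b) = ((3 * b).factorial : MvPolynomial (Fin 5) k) * X 0 ^ e := by
  have hcof : ∀ n : ℕ, pderiv 1 (X 0 ^ e * r' ^ n : MvPolynomial (Fin 5) k) = 0 := fun n => by
    rw [Derivation.leibniz, Derivation.leibniz_pow, Derivation.leibniz_pow, hr'1, pderiv_X_of_ne (show (0 : Fin 5) ≠ 1 by decide)]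
    simp
  have hexp : X 0 ^ e * r ^ b =
      (Finset.range (b + 1)).sum fun l => (b.choose l : MvPolynomial (Fin 5) k) * (X 1 ^ (3 * l) * (X 0 ^ e * r' ^ (b - l))) := by
    rw [hr, add_pow, Finset.mul_sum]
    refine Finset.sum_congr rfl fun l _ => ?_
    rw [← pow_mul]
    ring
  rw [hexp, iterate_pderiv_finset_sum, Finset.sum_eq_single b]
  · rw [iterate_pderiv_natCast_mul, X2Cubic4FloorFullCert.iterate_pderiv_X_pow_mul (1 : Fin 5) _ (hcof _) (3 * b) (3 * b), Nat.descFactorial_self, Nat.sub_self, Nat.sub_self,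
      Nat.choose_self]
    simp
  · intro l hl hne
    rw [iterate_pderiv_natCast_mul, X2Cubic4FloorFullCert.iterate_pderiv_X_pow_mul (1 : Fin 5) _ (hcof _) (3 * b) (3 * l),
      (Nat.descFactorial_eq_zero_iff_lt).mpr (by have := Finset.mem_range.mp hl; omega)]
    simp
  · intro hnot
    exact absurd (Finset.mem_range.mpr (Nat.lt_succ_self b)) hnot

/-- ★ **Stage 2: `∂₁^{3b}(∂₀^{3a}(c^h)) = C(h,a)·(3a)!·(3b)!`** for `c = X₀³ + r`, `r = X₁³ + r′`, `∂₀ r = 0`, `∂₁ r′ = 0`, `a + b = h`: in `c^h = Σⱼ C(h,j)X₀^{3j}r^{h−j}`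
the operator `∂₀^{3a}` kills `j < a`, and `∂₁^{3b}` kills `j > a` (`r^{h−j}` has `X₁`-degree `< 3b`); the survivor `j = a` contributes `C(h,a)(3a)!·∂₁^{3b}(r^b) = C(h,a)(3a)!(3b)!`.
[folklore computation] -/
theorem iterate_iterate_c_pow (h a b : ℕ) (hab : a + b = h) (c r r' : MvPolynomial (Fin 5) k) (hc : c = X 0 ^ 3 + r) (hr : r = X 1 ^ 3 + r')
    (hr0 : pderiv 0 r = 0) (hr'1 : pderiv 1 r' = 0) :
    (fun q => pderiv 1 q)^[3 * b] ((fun q => pderiv 0 q)^[3 * a] (c ^ h)) =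
      ((h.choose a * (3 * a).factorial * (3 * b).factorial : ℕ) : MvPolynomial (Fin 5) k) := by
  have hrpow : ∀ m : ℕ, pderiv 0 (r ^ m) = 0 := fun m => by rw [Derivation.leibniz_pow, hr0, smul_zero, smul_zero]
  have hexp : c ^ h = (Finset.range (h + 1)).sum fun j => (h.choose j : MvPolynomial (Fin 5) k) * (X 0 ^ (3 * j) * r ^ (h - j)) := by
    rw [hc, add_pow]
    refine Finset.sum_congr rfl fun j _ => ?_
    rw [← pow_mul]
    ring
  rw [hexp, iterate_pderiv_finset_sum, iterate_pderiv_finset_sum, Finset.sum_eq_single a]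
  · -- the survivor `j = a`
    rw [iterate_pderiv_natCast_mul, X2Cubic4FloorFullCert.iterate_pderiv_X_pow_mul (0 : Fin 5) _ (hrpow _) (3 * a) (3 * a), Nat.descFactorial_self, Nat.sub_self,
      show h - a = b by omega, iterate_pderiv_natCast_mul, iterate_pderiv_natCast_mul, iterate_pderiv_one_r_pow_self k b 0 r r' hr hr'1, pow_zero, mul_one]
    push_cast
    ring
  · intro j hj hne
    rw [iterate_pderiv_natCast_mul, X2Cubic4FloorFullCert.iterate_pderiv_X_pow_mul (0 : Fin 5) _ (hrpow _) (3 * a) (3 * j), iterate_pderiv_natCast_mul, iterate_pderiv_natCast_mul]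
    rcases lt_or_gt_of_ne hne with hlt | hgt
    · rw [(Nat.descFactorial_eq_zero_iff_lt).mpr (by omega)]
      simp
    · have hj' := Finset.mem_range.mp hj
      rw [iterate_pderiv_one_r_pow_eq_zero k b (h - j) (3 * j - 3 * a) (by omega) r r' hr hr'1]
      simp
  · intro hnot
    exact absurd (Finset.mem_range.mpr (by omega : a < h + 1)) hnot

/-! ## §4 The certificate, the clause at every closed point of `Y`, and the FULL vertex -/

/-- The arithmetic of the exponents: for a prime `p ∉ {2,3}`, with `h = (p−1)/2`, `b = ⌊(p−1)/3⌋`, `a = h − b`: `a + b = h`, `3a ≤ p−1`, `3b ≤ p−1`, `h < p`. [elementary] -/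
theorem exponent_arith (p : ℕ) (hp : p.Prime) (hp2 : p ≠ 2) (hp3 : p ≠ 3) :
    (p - 1) / 2 - (p - 1) / 3 + (p - 1) / 3 = (p - 1) / 2 ∧ 3 * ((p - 1) / 2 - (p - 1) / 3) < p ∧ 3 * ((p - 1) / 3) < p ∧ (p - 1) / 2 < p := by
  have h2 := hp.two_le
  have hodd : p % 2 = 1 := hp.eq_two_or_odd.resolve_left hp2
  have h3 : ¬ 3 ∣ p := fun hd => hp3 ((Nat.prime_dvd_prime_iff_eq Nat.prime_three hp).mp hd).symm
  omega

/-- ★★ **THE `p`-UNIFORM DERIVATIVE CERTIFICATE FOR THE VERTEX**: for every prime `p ∉ {2, 3}`, every field of characteristic `p`, and every `∂`-stable set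
`T ∋ f^{p−1}` (`f = X₄² + X₀³ + X₁³ + X₂³ + X₃³`): `1 ∈ (T)`. [OURS; cite: Fedder1983, Thm. 1.12 (context)] -/
theorem hcert_f (p : ℕ) [Fact p.Prime] [CharP k p] (hp2 : p ≠ 2) (hp3 : p ≠ 3) (f : MvPolynomial (Fin 5) k)
    (hf : f = X 4 ^ 2 + X 0 ^ 3 + X 1 ^ 3 + X 2 ^ 3 + X 3 ^ 3) :
    ∀ T : Set (MvPolynomial (Fin 5) k), f ^ (p - 1) ∈ T → (∀ s ∈ T, ∀ i : Fin 5, pderiv i s ∈ T) → (1 : MvPolynomial (Fin 5) k) ∈ Ideal.span T := by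
  intro T hfT hT
  have hp : p.Prime := Fact.out
  obtain ⟨hab, h3a, h3b, hh⟩ := exponent_arith p hp hp2 hp3
  -- stage 1
  have hf' : f = X 4 ^ 2 + (X 0 ^ 3 + X 1 ^ 3 + X 2 ^ 3 + X 3 ^ 3) := by rw [hf]; ring
  have hc4 : pderiv 4 (X 0 ^ 3 + X 1 ^ 3 + X 2 ^ 3 + X 3 ^ 3 : MvPolynomial (Fin 5) k) = 0 := by
    simp only [map_add, Derivation.leibniz_pow, pderiv_X_of_ne (show (0 : Fin 5) ≠ 4 by decide), pderiv_X_of_ne (show (1 : Fin 5) ≠ 4 by decide),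
      pderiv_X_of_ne (show (2 : Fin 5) ≠ 4 by decide), pderiv_X_of_ne (show (3 : Fin 5) ≠ 4 by decide), smul_zero, add_zero]
  have hcI := c_pow_mem k p hp2 f _ hf' hc4 T hfT hT
  -- stage 2
  have hr0 : pderiv 0 (X 1 ^ 3 + (X 2 ^ 3 + X 3 ^ 3) : MvPolynomial (Fin 5) k) = 0 := by
    simp only [map_add, Derivation.leibniz_pow, pderiv_X_of_ne (show (1 : Fin 5) ≠ 0 by decide), pderiv_X_of_ne (show (2 : Fin 5) ≠ 0 by decide),
      pderiv_X_of_ne (show (3 : Fin 5) ≠ 0 by decide), smul_zero, add_zero]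
  have hr'1 : pderiv 1 (X 2 ^ 3 + X 3 ^ 3 : MvPolynomial (Fin 5) k) = 0 := by
    simp only [map_add, Derivation.leibniz_pow, pderiv_X_of_ne (show (2 : Fin 5) ≠ 1 by decide), pderiv_X_of_ne (show (3 : Fin 5) ≠ 1 by decide),
      smul_zero, add_zero]
  have hD := iterate_span_pderiv_mem k T hT 1 (3 * ((p - 1) / 3))
    (iterate_span_pderiv_mem k T hT 0 (3 * ((p - 1) / 2 - (p - 1) / 3)) hcI)
  rw [iterate_iterate_c_pow k ((p - 1) / 2) ((p - 1) / 2 - (p - 1) / 3) ((p - 1) / 3) hab _ (X 1 ^ 3 + (X 2 ^ 3 + X 3 ^ 3)) (X 2 ^ 3 + X 3 ^ 3)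
    (by ring) rfl hr0 hr'1] at hD
  have hN : ((((p - 1) / 2).choose ((p - 1) / 2 - (p - 1) / 3) * (3 * ((p - 1) / 2 - (p - 1) / 3)).factorial * (3 * ((p - 1) / 3)).factorial : ℕ) : k) ≠ 0 := by
    rw [Nat.cast_mul, Nat.cast_mul]
    exact mul_ne_zero (mul_ne_zero (choose_cast_ne_zero k p _ _ (by omega) hh) (factorial_cast_ne_zero k p _ h3a)) (factorial_cast_ne_zero k p _ h3b)
  have := mem_of_natCast_mul_mem k hN (Ideal.span T) 1 (by rwa [mul_one])
  exact this

/-- `f ≠ 0`. [plumbing] -/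
theorem f_ne_zero (f : MvPolynomial (Fin 5) k) (hf : f = X 4 ^ 2 + X 0 ^ 3 + X 1 ^ 3 + X 2 ^ 3 + X 3 ^ 3) : f ≠ 0 := by
  intro h0
  have := congrArg (MvPolynomial.eval (Pi.single 4 1 : Fin 5 → k)) h0
  rw [hf] at this
  simp at this

/-- ★★ **THE FULL CLAUSE AT EVERY CLOSED POINT OF `Y = {x² + y³ + u³ + t³ + s³}`**, every prime `p ∉ {2, 3}`, every field of characteristic `p`: at every maximal ideal `Q` of
`k[X]/(f)` every parameter ideal of `(k[X]/(f))_Q` is generated by a regular sequence and is Frobenius closed. [OURS · assembly via `TCaFloorOneFull.clause_at_maximal_of_derivative_certificate`] -/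
theorem clause_f (p : ℕ) [Fact p.Prime] [CharP k p] (hp2 : p ≠ 2) (hp3 : p ≠ 3) (f : MvPolynomial (Fin 5) k)
    (hf : f = X 4 ^ 2 + X 0 ^ 3 + X 1 ^ 3 + X 2 ^ 3 + X 3 ^ 3)
    (Q : Ideal (MvPolynomial (Fin 5) k ⧸ Ideal.span {f})) [Q.IsMaximal] :
    ∀ d : ℕ, ringKrullDim (Localization.AtPrime Q) = d → ∀ s : Fin d → Localization.AtPrime Q,
      (Ideal.span (Set.range s)).radical.IsMaximal →
        RingTheory.Sequence.IsWeaklyRegular (Localization.AtPrime Q) (List.ofFn s) ∧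
        ∀ y : Localization.AtPrime Q, (∃ e : ℕ, y ^ p ^ e ∈ Ideal.span
          ((fun z : Localization.AtPrime Q => z ^ p ^ e) ''
            (Ideal.span (Set.range s) : Set (Localization.AtPrime Q)))) → y ∈ Ideal.span (Set.range s) :=
  TCaFloorOneFull.clause_at_maximal_of_derivative_certificate p k f (f_ne_zero k f hf) (hcert_f k p hp2 hp3 f hf) Q

/-- ★★★ **THE VERTEX OF `Y = {x² + y³ + u³ + t³ + s³}` IS FULL** for every prime `p ∉ {2,3}` and every field of characteristic `p`: `𝒪_{Y,v}` is a domain, Cohen–Macaulay, and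
every parameter ideal is Frobenius closed. With res-L1-w45a-lead-1 g10's ✓ `X2Cubic4Specimen` (`v` closed, singular, `dim 𝒪_{Y,v} = 4`) the base point of the second T″
kernel instance is a LEGAL base germ of the T″ stub (`y` closed, `y ∉ Reg`, `FullCl p 𝒪_{Y,y}`), in ALL characteristics `≥ 5`. [OURS · certificate; cite: Fedder1983, Thm. 1.12] -/
theorem fullCl_Spec_stalk_vertex (p : ℕ) [Fact p.Prime] [CharP k p] (hp2 : p ≠ 2) (hp3 : p ≠ 3) (f : MvPolynomial (Fin 5) k)
    (hf : f = X 4 ^ 2 + X 0 ^ 3 + X 1 ^ 3 + X 2 ^ 3 + X 3 ^ 3)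
    (v : Spec (.of (MvPolynomial (Fin 5) k ⧸ Ideal.span {f})))
    (hv : v.asIdeal = Ideal.span (Set.range fun j : Fin 5 => Ideal.Quotient.mk (Ideal.span {f}) (X j))) :
    FullCl p ((Spec (.of (MvPolynomial (Fin 5) k ⧸ Ideal.span {f}))).presheaf.stalk v) := by
  have h3 : (3 : k) ≠ 0 := (X2Cubic4Specimen.two_three_ne_zero k p hp2 hp3).2
  haveI := (Ideal.span_singleton_prime (X2Cubic4Specimen.prime_f k h3 f hf).ne_zero).mpr (X2Cubic4Specimen.prime_f k h3 f hf)
  haveI : IsDomain (MvPolynomial (Fin 5) k ⧸ Ideal.span {f}) := Ideal.Quotient.isDomain _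
  haveI : v.asIdeal.IsMaximal := by
    rw [hv]
    exact DoublePointFermatCubicGerm.isMaximal_origin k f (X2Cubic4Specimen.constantCoeff_f k f hf)
  haveI : IsDomain (Localization.AtPrime v.asIdeal) :=
    IsLocalization.isDomain_of_le_nonZeroDivisors _ v.asIdeal.primeCompl_le_nonZeroDivisors
  have hloc : FullCl p (Localization.AtPrime v.asIdeal) := ⟨inferInstance, clause_f k p hp2 hp3 f hf v.asIdeal⟩
  exact WFixAtNonClosedDimTwo.fullCl_of_ringEquiv p (Spec.stalkIso (.of _) v).commRingCatIsoToRingEquiv.symm hloc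

end Summit.ResolutionOfSingularities.ResolutionOfSingularities.Theorems.FInjectiveMacaulayfication.X2Cubic4VertexFull

end
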